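/-
Copyright (c) 2026 the pub-hodgecm-mathlib formalisation cell (harness21).  Prover seat hodgecm-mathlib-K2Liu-p07 (g3), Track B «K2-LIT»,
#184♮ = hLiu418 = `stmt-HodgeConjecture-24832`; #42S payer road, organ S1 (local Siegel–Weil spanning), ROAD W, file F5′-C1 (LEAD F0P6-plan (g14)
RULING «M-158a» (4) + BATCH #2 10:50:47Z: spec (ii) + (iv) of K2Liu-p06 (g4) 10:31:36Z (2), word scalar explicit per Weyl word).
-/
import Summits.HodgeConjecture.HodgeConjecture.Theorems.K2LiuLocalSWSimilitudeAlgebra      -- ★ F5′-A1: the letter `D₀`, `formCongr_dA`, `adapt_matA_localCongr_dA`, …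
import Literature.NumberTheory.K2Lit.DoubledUnitaryDegeneratePrincipalSeries                -- ★ D1: `localDegPS`, `localSiegelCharacter`, `absDetDelta`
import Literature.NumberTheory.GelbartRogawski1991.LocalDoubledUnitaryUnramifiedCell          -- ★ `nElem`, `adapt_matA_nElem`
import HarnessLib

/-!
# Crux `HLiu418`, #42S organ S1, ROAD W, file F5′-C1: SIEGEL SECTIONS UNDER `Ad(d_a)` — `D_a f := f ∘ Ad(d_a)` PRESERVES `I_v(s, χ_v)`, AND THE WORD LAWS
# `Ad(d_a) n(t) = n(a⁻¹t)`, `Ad(d_a) w_Δ = ℓ_a · w_Δ` WITH `ℓ_a ∈ M_Δ`, `det_Δ ℓ_a = a^{−n}` (the scalar `χ_v(det_Δ ℓ_a)|det_Δ ℓ_a|^{s+n∕2}` explicit)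

Cell `hodgecm-mathlib`, crux item hLiu418 = `stmt-HodgeConjecture-24832`; squad K2 ∕ K2Liu; LEAD F0P6-plan (g14), organ lead K2Liu-p06 (g4); prover
K2Liu-p07 (g3).  THEOREMS ONLY (no `def`, no instance, no notation, no named-fact hypothesis, no `sorry`); lane `--supports stmt-HodgeConjecture-24832 --as helper`.

WHY (spec K2Liu-p06 (g4) 10:31:36Z (2) (i)(ii)(iv); ruling «M-158a» (4) and ADDENDUM (3)).  With `V⁻ ≅ (V⁺, a·h)` the `V⁻`-Siegel–Weil image is `D_a R₂(V⁺_v)`,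
`D_a f = f ∘ Ad(d_a)`; ROAD W evaluates big-cell profiles `f(w_Δ n(b))` and rank-one values, so it needs: (ii) `D_a` preserves `I_v(s, χ_v)` (★ `localDegPS`) and is
compatible with right translation; (iv) the WORD LAWS — `Ad(d_a)` fixes `P_Δ`, maps `n(t) ↦ n(a⁻¹ t)` and `w_Δ ↦ ℓ_a w_Δ` with `ℓ_a ∈ M_Δ` of adapted matrix
`diag(a⁻¹·1, a·1)`, so `(D_a f)(w_Δ u) = χ_v(det_Δ ℓ_a)|det_Δ ℓ_a|_v^{s+n∕2} · f(w_Δ · Ad(d_a) u)` with `det_Δ ℓ_a = a^{−n}` at every `w ∣ v` (the ramified closer of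
F7 reads `χ_w(a)^{−rank}`: LEAD ADDENDUM (3)).  `Ad(d_a) = ★ localCongr E c DA _ (formCongr_dA …) v` (F5′-A1, no new definition).
* §1 (ANY endomorphism `θ`): `isLocalSiegelSection_comp`, `isSmooth_comp`, **`comp_mem_localDegPS`** (under (h3) `θ P_Δ ⊆ P_Δ` and the invariance of
  ★ `localSiegelCharacter`), `comp_rightTranslate` (`D(R(θ g) f) = R(g)(D f)`).
* §2 `θ = Ad(d_a)`: `absDetDelta_localCongr_dA`, **`localSiegelCharacter_localCongr_dA`** (on `P_Δ`), **`comp_localCongr_dA_mem_localDegPS`** = (ii).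
* §3 words: **`localCongr_dA_nElem`** (`Ad(d_a) n(t) = n(a_v⁻¹ t)`), `adapt_matA_leviOfWeyl` (`ℓ_a := Ad(d_a)(w_Δ)·w_Δ` has adapted matrix `diag(a_v⁻¹·1, a_v·1)`),
  `isSiegelDelta_leviOfWeyl`, **`detDelta_leviOfWeyl`** (`det_Δ(ℓ_a)_w = (a_w⁻¹)^n`), `localCongr_dA_weylDelta` (`Ad(d_a) w_Δ = ℓ_a · w_Δ`), and the WORD LAW
  **`comp_localCongr_dA_apply_weylDelta_mul`**: `(D_a f)(w_Δ u) = localSiegelCharacter χ_v s ℓ_a · f(w_Δ · Ad(d_a) u)` for `f ∈ I_v(s, χ_v)`; the generic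
  **`comp_apply_mul_of_eq_levi_mul`** does the same for ANY word `x` with `Ad(d_a) x = ℓ · x`, `ℓ ∈ P_Δ` (the rank-one `w₁` of F6∕F7: `ℓ` has `det_Δ = a^{−1}`, read off
  ★ `adapt_matA_localCongr_dA`).
References: [Kudla1994] §3 Thm. 3.1; [HarrisKudlaSweet1996] §1 (1.11), (1.15); [MoeglinVignerasWaldspurger1987] Chap. 1 I.17, Chap. 2 II.1; [Liu2021] §B.3 p. 101.
HONEST LABEL.  Count-neutral helper: `HC_CM` is proved only modulo the 7 printed citations (2 remaining named inputs: hLiu418 = `stmt-HodgeConjecture-24832`,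
h413 = `stmt-HodgeConjecture-24833`) until rung 0 closes.
-/

set_option autoImplicit false
set_option linter.dupNamespace false -- the mandated namespace repeats `HodgeConjecture.HodgeConjecture`

noncomputable section

open scoped Matrix
open NumberField IsDedekindDomain Matrix
open Literature.NumberTheory.Automorphic Literature.NumberTheory.Automorphic.UnitaryGroup
open Literature.NumberTheory.GelbartRogawski1991.AdaptedBlocks
open Literature.NumberTheory.GelbartRogawski1991.UnitaryDualPair.LocalSplitting
open Literature.NumberTheory.K2Lit.LocalSiegelDoubled
open Summit.HodgeConjecture.HodgeConjecture.Cruxes.HLiu418.K2LiuLocalSWSimilitudeAlgebra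

namespace Summit.HodgeConjecture.HodgeConjecture.Cruxes.HLiu418.K2LiuLocalSWSimilitudeSections

variable (F : Type) [Field F] [NumberField F] (E : Type) [Field E] [NumberField E] [Algebra F E] [Algebra.IsQuadraticExtension F E]
  (c : E ≃ₐ[F] E) {δ : E} (hcδ : c δ = -δ) (hδ : δ ≠ 0) {d : F} (hd : δ * δ = algebraMap F E d)
  (v : HeightOneSpectrum (𝓞 F)) (n : ℕ) {T₀ : Matrix (Fin n) (Fin n) F} (hT₀ : T₀.IsSymm)
  {JD : Matrix (Fin (n + n)) (Fin (n + n)) E} (hJD : JD = (gramD F n T₀).map (algebraMap F E))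
  (χv : ∀ w : PlacesOver E v, (w.1.adicCompletion E)ˣ →* ℂˣ) (s : ℂ)

/-! ## §1 Siegel sections under a `P_Δ`-preserving endomorphism -/

section Generic

variable (θ : UnitaryGroup.localPi E c (n + n) JD v →* UnitaryGroup.localPi E c (n + n) JD v)

/-- **a `P_Δ`-preserving endomorphism fixing the inducing character carries Siegel sections to Siegel sections** (`f ↦ f ∘ θ`).
[cite: HarrisKudlaSweet1996, §1 (1.15)] -/
theorem isLocalSiegelSection_comp
    (hθP : ∀ p, IsSiegelDelta F E c hcδ hδ hd v n hT₀ hJD p → IsSiegelDelta F E c hcδ hδ hd v n hT₀ hJD (θ p))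
    (hθχ : ∀ p, IsSiegelDelta F E c hcδ hδ hd v n hT₀ hJD p → localSiegelCharacter F E c v n χv s (θ p) = localSiegelCharacter F E c v n χv s p)
    {f : UnitaryGroup.localPi E c (n + n) JD v → ℂ} (hf : IsLocalSiegelSection F E c hcδ hδ hd v n hT₀ hJD χv s f) :
    IsLocalSiegelSection F E c hcδ hδ hd v n hT₀ hJD χv s (f ∘ θ) := by
  intro p hp h
  rw [Function.comp_apply, Function.comp_apply, map_mul, hf (θ p) (hθP p hp) (θ h), hθχ p hp]

omit [Algebra.IsQuadraticExtension F E] in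
/-- a continuous endomorphism carries smooth functions to smooth functions (`f ↦ f ∘ θ`; the open stabiliser pulls back).
[cite: HarrisKudlaSweet1996, §1 (1.15)] -/
theorem isSmooth_comp (hθ : Continuous θ) {f : UnitaryGroup.localPi E c (n + n) JD v → ℂ} (hf : IsSmooth F E c v n f) :
    IsSmooth F E c v n (f ∘ θ) := by
  obtain ⟨U, hU⟩ := hf
  refine ⟨U.comap θ hθ, fun h u hu => ?_⟩
  rw [Function.comp_apply, Function.comp_apply, map_mul]
  exact hU (θ h) (θ u) (by simpa using hu)

/-- **`f ∈ I_v(s, χ_v) ⇒ f ∘ θ ∈ I_v(s, χ_v)`** for a continuous `P_Δ`-preserving endomorphism fixing the inducing character.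
[cite: HarrisKudlaSweet1996, §1 (1.15)] [cite: Liu2021, §B.3 p. 101] -/
theorem comp_mem_localDegPS (hθ : Continuous θ)
    (hθP : ∀ p, IsSiegelDelta F E c hcδ hδ hd v n hT₀ hJD p → IsSiegelDelta F E c hcδ hδ hd v n hT₀ hJD (θ p))
    (hθχ : ∀ p, IsSiegelDelta F E c hcδ hδ hd v n hT₀ hJD p → localSiegelCharacter F E c v n χv s (θ p) = localSiegelCharacter F E c v n χv s p)
    {f : UnitaryGroup.localPi E c (n + n) JD v → ℂ} (hf : f ∈ localDegPS F E c hcδ hδ hd v n hT₀ hJD χv s) :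
    f ∘ θ ∈ localDegPS F E c hcδ hδ hd v n hT₀ hJD χv s :=
  ⟨isLocalSiegelSection_comp F E c hcδ hδ hd v n hT₀ hJD χv s θ hθP hθχ hf.1, isSmooth_comp F E c v n θ hθ hf.2⟩

omit [Algebra.IsQuadraticExtension F E] in
/-- **compatibility with right translation**: `(f ∘ θ)(· g) = (f(· θ g)) ∘ θ`, i.e. `D(R(θ g) f) = R(g)(D f)`. [cite: HarrisKudlaSweet1996, §1 (1.15)] -/
theorem comp_rightTranslate (f : UnitaryGroup.localPi E c (n + n) JD v → ℂ) (g : UnitaryGroup.localPi E c (n + n) JD v) :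
    (fun h => (f ∘ θ) (h * g)) = (fun h => f (h * θ g)) ∘ θ := by
  funext h
  simp only [Function.comp_apply, map_mul]

/-- **the generic WORD LAW**: if `θ x = ℓ · x` with `ℓ ∈ P_Δ` then `(f ∘ θ)(x u) = χ_v(det_Δ ℓ)|det_Δ ℓ|^{s+n∕2} · f(x · θ u)` for every Siegel section `f`.
[cite: HarrisKudlaSweet1996, §1 (1.15)] -/
theorem comp_apply_mul_of_eq_levi_mul {x ℓ : UnitaryGroup.localPi E c (n + n) JD v} (hx : θ x = ℓ * x)
    (hℓ : IsSiegelDelta F E c hcδ hδ hd v n hT₀ hJD ℓ)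
    {f : UnitaryGroup.localPi E c (n + n) JD v → ℂ} (hf : IsLocalSiegelSection F E c hcδ hδ hd v n hT₀ hJD χv s f)
    (u : UnitaryGroup.localPi E c (n + n) JD v) :
    (f ∘ θ) (x * u) = localSiegelCharacter F E c v n χv s ℓ * f (x * θ u) := by
  rw [Function.comp_apply, map_mul, hx, mul_assoc, hf ℓ hℓ]

end Generic

/-! ## §2 `θ = Ad(d_a)`: the inducing character is `Ad(d_a)`-invariant on `P_Δ`; `D_a` preserves `I_v(s, χ_v)` -/

section Similitude

variable (a : Fˣ) {D₀ : GL (Fin (n + n)) F}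
  (hD₀ : (D₀ : Matrix (Fin (n + n)) (Fin (n + n)) F) =
    Matrix.reindex (e₂ n) (e₂ n) (cayR F (Fin n) * Matrix.fromBlocks 1 0 0 ((a : F) • (1 : Matrix (Fin n) (Fin n) F)) * cayRinv F (Fin n)))
  {DA : GL (Fin (n + n)) E} (hDA : DA = Matrix.GeneralLinearGroup.map (algebraMap F E) D₀)
  {b : E} (hb : b ≠ 0) (hDAJ : formCongr (c : E →+* E) DA (b • JD) = JD)

include hD₀ hDA in
/-- `|det_Δ(d_a p d_a⁻¹)|_v = |det_Δ p|_v` on `P_Δ`. [cite: HarrisKudlaSweet1996, §1 (1.15)] -/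
theorem absDetDelta_localCongr_dA {p : UnitaryGroup.localPi E c (n + n) JD v} (hp : IsSiegelDelta F E c hcδ hδ hd v n hT₀ hJD p) :
    absDetDelta F E c v n (localCongr E c DA hb hDAJ v p) = absDetDelta F E c v n p :=
  Finset.prod_congr rfl fun w _ => norm_detDelta_localCongr_dA F E c v n hJD a hD₀ hDA hb hDAJ hcδ hδ hd hT₀ hp w

include hD₀ hDA in
/-- **the inducing character is `Ad(d_a)`-invariant on `P_Δ`**: `χ_v(det_Δ(d_a p d_a⁻¹))|det_Δ(d_a p d_a⁻¹)|^{s+n∕2} = χ_v(det_Δ p)|det_Δ p|^{s+n∕2}`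
(`d_a` is the identity on `Δ`). [cite: HarrisKudlaSweet1996, §1 (1.15)] [cite: Kudla1994, §3] -/
theorem localSiegelCharacter_localCongr_dA {p : UnitaryGroup.localPi E c (n + n) JD v} (hp : IsSiegelDelta F E c hcδ hδ hd v n hT₀ hJD p) :
    localSiegelCharacter F E c v n χv s (localCongr E c DA hb hDAJ v p) = localSiegelCharacter F E c v n χv s p := by
  rw [localSiegelCharacter, localSiegelCharacter, chiDet_localCongr_dA F E c v n hJD a hD₀ hDA hb hDAJ hcδ hδ hd hT₀ χv hp,
    absDetDelta_localCongr_dA F E c hcδ hδ hd v n hT₀ hJD a hD₀ hDA hb hDAJ hp]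

include hD₀ hDA in
/-- **(ii) `D_a f := f ∘ Ad(d_a)` PRESERVES `I_v(s, χ_v)`**: `f ∈ localDegPS χ_v s ⇒ f ∘ Ad(d_a) ∈ localDegPS χ_v s` (`Ad(d_a)` = ★ `localCongr`, a continuous
automorphism fixing `P_Δ` and the inducing character). [cite: HarrisKudlaSweet1996, §1 (1.15)] [cite: MoeglinVignerasWaldspurger1987, Chap. 2 II.1] -/
theorem comp_localCongr_dA_mem_localDegPS {f : UnitaryGroup.localPi E c (n + n) JD v → ℂ}
    (hf : f ∈ localDegPS F E c hcδ hδ hd v n hT₀ hJD χv s) :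
    f ∘ (localCongr E c DA hb hDAJ v) ∈ localDegPS F E c hcδ hδ hd v n hT₀ hJD χv s :=
  comp_mem_localDegPS F E c hcδ hδ hd v n hT₀ hJD χv s (localCongr E c DA hb hDAJ v).toMonoidHom (localCongr E c DA hb hDAJ v).continuous
    (fun p hp => (isSiegelDelta_localCongr_dA_iff F E c v n hJD a hD₀ hDA hb hDAJ hcδ hδ hd hT₀ p).2 hp)
    (fun _ hp => localSiegelCharacter_localCongr_dA F E c hcδ hδ hd v n hT₀ hJD χv s a hD₀ hDA hb hDAJ hp) hf

/-! ## §3 The word laws: `Ad(d_a) n(t) = n(a⁻¹ t)`, `Ad(d_a) w_Δ = ℓ_a w_Δ` -/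

omit [Algebra.IsQuadraticExtension F E] in
include hD₀ hDA in
/-- **`Ad(d_a) n(t) = n(a_v⁻¹ · t)`** on the unipotent radical `N_Δ(F_v)`. [cite: Kudla1994, §3] [cite: HarrisKudlaSweet1996, §1 (1.11)] -/
theorem localCongr_dA_nElem (t : Matrix (Fin n) (Fin n) (LocalRing E v)) (ht : (t.map (conjLocal E c v))ᵀ * gramS F E v n T₀ + gramS F E v n T₀ * t = 0) :
    localCongr E c DA hb hDAJ v (nElem F E c v n hJD t ht) =
      nElem F E c v n hJD ((toLocalRing E v (((a⁻¹ : Fˣ) : F) : v.adicCompletion F)) • t)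
        (by rw [Matrix.map_smul' _ _ _ (map_mul _), conjLocal_toLocalRing, Matrix.transpose_smul, Matrix.smul_mul, Matrix.mul_smul, ← smul_add, ht, smul_zero]) := by
  refine matA_injective F E c v n (eq_of_adapt_eq ?_)
  have h := adapt_matA_nElem F E c v n hJD t ht
  rw [adapt_eq] at h
  obtain ⟨hA, hB, hC, hD⟩ := Matrix.fromBlocks_inj.1 h
  rw [adapt_matA_localCongr_dA F E c v n a hD₀ hDA hb hDAJ, adapt_matA_nElem, hA, hB, hC, hD, smul_zero]

omit [Algebra.IsQuadraticExtension F E] in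
include hD₀ hDA in
/-- **`ℓ_a := Ad(d_a)(w_Δ) · w_Δ` has adapted matrix `diag(a_v⁻¹·1, a_v·1)`** (so `Ad(d_a) w_Δ = ℓ_a w_Δ`, `w_Δ² = 1`). [cite: Kudla1994, §3] -/
theorem adapt_matA_leviOfWeyl :
    adapt (matA F E c v n (localCongr E c DA hb hDAJ v (weylDelta F E c v n hJD) * weylDelta F E c v n hJD)) =
      Matrix.fromBlocks ((toLocalRing E v (((a⁻¹ : Fˣ) : F) : v.adicCompletion F)) • (1 : Matrix (Fin n) (Fin n) (LocalRing E v))) 0 0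
        ((toLocalRing E v ((a : F) : v.adicCompletion F)) • (1 : Matrix (Fin n) (Fin n) (LocalRing E v))) := by
  have hw : adapt (matA F E c v n (weylDelta F E c v n hJD (T₀ := T₀))) = Matrix.fromBlocks 0 1 1 0 :=
    adapt_matA_ofAdapted F E c v n hJD (Matrix.fromBlocks 0 1 1 0) (isUnit_det_weylAd F E v n) (cstar_weylAd (conjLocal E c v) _)
  have hblk : blkA (matA F E c v n (weylDelta F E c v n hJD (T₀ := T₀))) = 0 ∧ blkB (matA F E c v n (weylDelta F E c v n hJD (T₀ := T₀))) = 1 ∧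
      blkC (matA F E c v n (weylDelta F E c v n hJD (T₀ := T₀))) = 1 ∧ blkD (matA F E c v n (weylDelta F E c v n hJD (T₀ := T₀))) = 0 := by
    have hw' := hw
    rw [adapt_eq] at hw'
    exact Matrix.fromBlocks_inj.1 hw'
  rw [← matA_mul, adapt_mul, adapt_matA_localCongr_dA F E c v n a hD₀ hDA hb hDAJ, hblk.1, hblk.2.1, hblk.2.2.1, hblk.2.2.2, hw,
    Matrix.fromBlocks_multiply]
  simp only [Matrix.mul_zero, Matrix.mul_one, zero_add, add_zero]

include hD₀ hDA in
/-- `ℓ_a ∈ P_Δ(F_v)` (indeed in the Levi `M_Δ`). [cite: Kudla1994, §3] -/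
theorem isSiegelDelta_leviOfWeyl :
    IsSiegelDelta F E c hcδ hδ hd v n hT₀ hJD (localCongr E c DA hb hDAJ v (weylDelta F E c v n hJD) * weylDelta F E c v n hJD) := by
  rw [isSiegelDelta_iff_blkC_eq_zero, blkC_eq_toBlocks₂₁_adapt, adapt_matA_leviOfWeyl F E c v n hJD a hD₀ hDA hb hDAJ, Matrix.toBlocks_fromBlocks₂₁]

omit [Algebra.IsQuadraticExtension F E] in
include hD₀ hDA in
/-- **`det_Δ(ℓ_a)_w = (a_w⁻¹)^n`** at every `w ∣ v` (`a_w = ι_w(a)`). [cite: Kudla1994, §3] [cite: HarrisKudlaSweet1996, §1 (1.15)] -/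
theorem detDelta_leviOfWeyl (w : PlacesOver E v) :
    detDelta F E c v n w (localCongr E c DA hb hDAJ v (weylDelta F E c v n hJD) * weylDelta F E c v n hJD) =
      (toLocalRing E v (((a⁻¹ : Fˣ) : F) : v.adicCompletion F) w) ^ n := by
  have h := adapt_matA_leviOfWeyl F E c v n hJD a hD₀ hDA hb hDAJ
  rw [adapt_eq] at h
  obtain ⟨hA, -, hC, -⟩ := Matrix.fromBlocks_inj.1 h
  rw [detDelta_eq, hA, hC, add_zero, Matrix.smul_one_eq_diagonal, Matrix.det_diagonal]
  simp only [Finset.prod_const, Finset.card_univ, Fintype.card_fin, Pi.pow_apply]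

omit [Algebra.IsQuadraticExtension F E] in
include hD₀ hDA in
/-- `|det_Δ ℓ_a|_v = ∏_w ‖a_w‖^{−n}` (as `∏_w ‖(a_w⁻¹)^n‖`). [cite: HarrisKudlaSweet1996, §1 (1.15)] -/
theorem absDetDelta_leviOfWeyl :
    absDetDelta F E c v n (localCongr E c DA hb hDAJ v (weylDelta F E c v n hJD) * weylDelta F E c v n hJD) =
      ∏ w : PlacesOver E v, ‖(toLocalRing E v (((a⁻¹ : Fˣ) : F) : v.adicCompletion F) w) ^ n‖ :=
  Finset.prod_congr rfl fun w _ => by rw [detDelta_leviOfWeyl F E c v n hJD a hD₀ hDA hb hDAJ w]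

omit [Algebra.IsQuadraticExtension F E] in
/-- **`Ad(d_a) w_Δ = ℓ_a · w_Δ`**. [cite: Kudla1994, §3] -/
theorem localCongr_dA_weylDelta :
    localCongr E c DA hb hDAJ v (weylDelta F E c v n hJD) =
      (localCongr E c DA hb hDAJ v (weylDelta F E c v n hJD) * weylDelta F E c v n hJD) * weylDelta F E c v n hJD := by
  rw [mul_assoc, weylDelta_mul_self, mul_one]

include hD₀ hDA in
/-- **(iv) THE WORD LAW AT `w_Δ`**: `(D_a f)(w_Δ u) = χ_v(det_Δ ℓ_a)|det_Δ ℓ_a|_v^{s+n∕2} · f(w_Δ · Ad(d_a) u)` for every Siegel section `f`, where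
`det_Δ(ℓ_a)_w = (a_w⁻¹)^n` (`detDelta_leviOfWeyl`); with `localCongr_dA_nElem`: `(D_a f)(w_Δ n(t)) = χ_v(det_Δ ℓ_a)|det_Δ ℓ_a|^{s+n∕2} · f(w_Δ n(a⁻¹t))`.
[cite: HarrisKudlaSweet1996, §1 (1.15)] [cite: Kudla1994, §3] -/
theorem comp_localCongr_dA_apply_weylDelta_mul {f : UnitaryGroup.localPi E c (n + n) JD v → ℂ}
    (hf : IsLocalSiegelSection F E c hcδ hδ hd v n hT₀ hJD χv s f) (u : UnitaryGroup.localPi E c (n + n) JD v) :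
    (f ∘ (localCongr E c DA hb hDAJ v)) (weylDelta F E c v n hJD * u) =
      localSiegelCharacter F E c v n χv s (localCongr E c DA hb hDAJ v (weylDelta F E c v n hJD) * weylDelta F E c v n hJD) *
        f (weylDelta F E c v n hJD * localCongr E c DA hb hDAJ v u) :=
  comp_apply_mul_of_eq_levi_mul F E c hcδ hδ hd v n hT₀ hJD χv s (localCongr E c DA hb hDAJ v).toMonoidHom
    (localCongr_dA_weylDelta F E c v n hJD hb hDAJ) (isSiegelDelta_leviOfWeyl F E c hcδ hδ hd v n hT₀ hJD a hD₀ hDA hb hDAJ) hf u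

end Similitude

end Summit.HodgeConjecture.HodgeConjecture.Cruxes.HLiu418.K2LiuLocalSWSimilitudeSections

end
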